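import Summits.QuantumFields.BalabanUV.Beta.GAN24.T2RecChargeStepMap
import Summits.QuantumFields.BalabanUV.Beta.GAN24.TableDressingZeroMode

/-!
# `BalabanUV.Beta.GAN24.T2RecChargeStepFourFace` — binder row G-an2-4 ∕ (CONV-C), CT-W (F2) ∕ (R-DEV): **THE ONE-STEP CHARGE LAWS OF THE DRESSED COMB
# STEP IN FOUR-FACE FORM** — Part 3 of `T2RecChargeStep`: leaf-02 g52's identity `zmode_N (𝔇Y) = N⁴·fourFace_N (Y)` (`TableDressingZeroMode.zmode_tableDress_ff`)
# substituted into Part 1 §2 (`zmode_succ_eq`) and Part 2 §2 (`zmode_stepE_eq`): the dressed second-order step reads the FOUR EXIT-FACE charge of its input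

NOT IN PRINT; OUR BOOKKEEPING (road-P2 chair of row G-an2-4, unit `b2b-balaban-gan24-p2` gen 36, crux team (2); journal [GAN24P2-G36-INTENT1] Part 3).
HONEST FRAMING (cell contract, verbatim): «discharging `BetaPertH` makes Bałaban's UV stability UNCONDITIONAL — a real constructive-QFT result; it is
NOT the continuum limit and NOT the Clay problem.»  HONEST DEPENDENCY (verbatim): «continuum YM on T⁴ ⇐ BetaPertH ∧ nine spine estimates (0/9 proved);
BetaPertH ⇐ (D1) ∧ (D4) ∧ CAP+tail; G-an2-4 gates asym, D1 and NE2/3/4.»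

WHAT (generic `d`, in-block root, every `j`, every `N`, all constants symbolic, NO pin; [folklore] one `rw` each; 0 `def`, 0 cite, 0 sorry).  With
`FF_Lc(Y)(κ,κ′;a,b) := Σ_{r′ ∈ box, r′_κ ≡ −1} Σ'_{u′ : u′_κ′ ≡ −1} Σ'_{x : x_a ≡ −1} Σ'_{z : z_b ≡ −1} Y κ (toSite r′) κ′ u′ x z (inl a) (inl b)` (residues mod `Lc`;
leaf-02's literal `if … then … else 0` form VERBATIM) and `λ̂ := N^{d+1}·(cE₂·Lc^{2(d+1)})·(½·((Lc^{d+2})⁻¹)^4)`: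
* **`zmode_succ_eq_fourFace`**: `zmode N T̃_{j+1} (μ,ν;α,β) = zmode N b̃_j (μ,ν;α,β) + λ̂·Lc⁴·(FF_Lc(T̃_j)(μ,ν;α,β) + FF_Lc(T̃_j)(ν,μ;α,β))` — the kernel face of the
  OWNER's (N1) `Z(𝒜^E₀T₀) = 9·Z(𝒜^B₀T₀)` at D = 2, Lc = 3 (R-gan24p1-g23-1).
* **`zmode_stepE_eq_fourFace (X)`**: the same for the dressed step as an affine map on an arbitrary jointly-covariant `LocStencil₂` input `X`.
* `memberB_translate`, **`zmodeSym_devForcing_eq_fourFace`**: the bond-symmetrised charge of the OWNER's (R-DEV) forcing `g′_j = ((𝒜^E_j − 𝒜^B_j) T_j) + (b̃_j − b^B_j)`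
  in closed form: `= [zmodeSym b̃_j − zmodeSym b^B_j] + 2λ̂·[Lc⁴·fourFaceSym_Lc (T_j) − zmodeSym_Lc (T_j)]` — R4's «(Z′) false at j = 1» reads this line.
Asserts NO value of Bałaban's tables; discharges NOTHING of (Z′), (C), «T2Shape», «T2Drift», (hW, hWall); NEVER «G-an2-4 closed» as (CONV-C); NOT D1, NOT
BetaPertH, NOT continuum, NOT Clay.  2026-08-22.
-/

noncomputable section

open Finset
open scoped BigOperators
open Literature.MathematicalPhysics.QuantumFieldTheory
open Literature.MathematicalPhysics.QuantumFieldTheory.Balaban1983to89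
open Literature.MathematicalPhysics.QuantumFieldTheory.Balaban1983to89.Beta
open ExpKernelCalculus (MKer Decays shiftK)
open OneStepResolventKernel (Fib)
open OneStepKernelFamily (KInvStep shiftK_KInvStep)
open AffineAveraging (Site box toSite)
open BalabanCompositeJets (LocStencil₂)
open SecondOrderResponse (W2SymOfK)
open BalabanStepJetsSucc (mmRead)
open BalabanStepW2 (K3OfK M2Of)
open AveragingMixedJetTables (mixFFAt)
open Summit.QuantumFields.BalabanUV.Beta.HessKerDressedUnits (unitK unitS)
open Summit.QuantumFields.BalabanUV.Beta.SecondOrderUnits (unitM unitS₂ unitM₂)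
open Summit.QuantumFields.BalabanUV.Beta.AxialDressingRooted (coProjBmAtK coDressKBmAt dressKBmAt)
open Summit.QuantumFields.BalabanUV.Beta.SpineRooted (T2RecOf T2RecAt SpureRecAt M1At T2RecOf_translate SpureRecAt_translate M1At_translate)
open Summit.QuantumFields.BalabanUV.Beta.MixedJetTablesPlug (hmixt_an1)
open Summit.QuantumFields.BalabanUV.Beta.GAN24.T2SlotCovariance (unitS₂_translate)
open Summit.QuantumFields.BalabanUV.Beta.GAN24.CombesThomas (sfStep smStep)
open Summit.QuantumFields.BalabanUV.Beta.GAN24.T2RecursionAffine (lin4)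
open Summit.QuantumFields.BalabanUV.Beta.GAN24.BiStencilZeroMode (Tab zmode)
open Summit.QuantumFields.BalabanUV.Beta.GAN24.T2RecChargeStep (shape_member member_translate zmode_succ_eq)
open Summit.QuantumFields.BalabanUV.Beta.GAN24.T2RecChargeStepMap (zmode_stepE_eq zmode_stepB_eq shape_memberB)
open Summit.QuantumFields.BalabanUV.Beta.GAN24.TableDressingZeroMode (zmode_tableDress_ff)

namespace Summit.QuantumFields.BalabanUV.Beta.GAN24.T2RecChargeStepFourFace

variable {d : ℕ} {Lc : ℕ} [NeZero Lc] {r : Fin (d + 1) → ℕ}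

/-- NOT IN PRINT; OUR BOOKKEEPING ([folklore] Part 1 §2 `zmode_succ_eq` ∘ leaf-02 g52's `zmode_tableDress_ff` on the member `T̃_j`, which is `LocStencil₂`
(`shape_member`) and jointly `Lc`-covariant (`member_translate`)).  **THE ONE-STEP CHARGE LAW OF THE DRESSED COMB TOWER, FOUR-FACE FORM**:
`zmode N T̃_{j+1} (μ,ν;α,β) = zmode N b̃_j (μ,ν;α,β) + λ̂·Lc⁴·(FF_Lc(T̃_j)(μ,ν;α,β) + FF_Lc(T̃_j)(ν,μ;α,β))` — the dressed linear part reads the FOUR EXIT-FACE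
charge of the member (at member 0, ultra-local, this is `Lc²·zmode` on the charged patterns: the OWNER's (N1)). -/
theorem zmode_succ_eq_fourFace (hLc : 1 ≤ Lc) (hr : r ∈ box (d + 1) Lc) (cE cVH cΛ cE₂ cB : ℝ) (Tc : Fin 4 → Fin 4 → Fin 4 → Fin 4 → ℝ)
    {vh₂S : Tab d} (hBff : ∀ κ u κ' u' x z (α β : Fin (d + 1)), vh₂S κ u κ' u' x z (Sum.inl α) (Sum.inl β) = 0)
    (hBmm : ∀ κ u κ' u' x z (μ ν : Fin (d + 1)), vh₂S κ u κ' u' x z (Sum.inr μ) (Sum.inr ν) = 0)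
    (hB : ∃ C δ : ℝ, 0 < δ ∧ LocStencil₂ vh₂S C δ)
    (hBt : ∀ (κ : Fin (d + 1)) (u : Fin (d + 1) → ℤ) (κ' : Fin (d + 1)) (u' t : Fin (d + 1) → ℤ),
      vh₂S κ (u + (Lc : ℤ) • t) κ' (u' + (Lc : ℤ) • t) = shiftK (-((Lc : ℤ) • t)) (vh₂S κ u κ' u'))
    (N j : ℕ) (μ ν α β : Fin (d + 1)) :
    zmode N (unitS₂ (sfStep Lc (j + 1)) (smStep d Lc (j + 1)) (T2RecAt d Lc (toSite r) cE cVH cΛ cE₂ cB Tc vh₂S (mixFFAt (toSite r) Lc) (j + 1)))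
        μ ν (Sum.inl α) (Sum.inl β)
      = zmode N (fun κ u κ' u' => (cE₂ * (Lc : ℝ) ^ (2 * (d + 1))) • mmRead Lc (K3OfK
            (unitK (sfStep Lc j) (smStep d Lc j) (coDressKBmAt (toSite r) Lc (KInvStep (d := d) Lc j))) Lc
            (unitS (sfStep Lc j) (smStep d Lc j) (SpureRecAt d Lc (toSite r) cE cVH cΛ j)) (unitM (sfStep Lc j) (smStep d Lc j) (M1At d Lc (toSite r) cΛ j))
            (W2SymOfK (unitK (sfStep Lc j) (smStep d Lc j) (coDressKBmAt (toSite r) Lc (KInvStep (d := d) Lc j))) Lc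
              (unitS (sfStep Lc j) (smStep d Lc j) (SpureRecAt d Lc (toSite r) cE cVH cΛ j)) (unitM (sfStep Lc j) (smStep d Lc j) (M1At d Lc (toSite r) cΛ j)) 0
              (unitM₂ (sfStep Lc j) (smStep d Lc j) (M2Of d Lc (mixFFAt (toSite r) Lc) j))) κ u κ' u') + cB • vh₂S κ u κ' u')
          μ ν (Sum.inl α) (Sum.inl β)
        + ((N : ℝ) ^ (d + 1)) * ((cE₂ * (Lc : ℝ) ^ (2 * (d + 1))) * ((1 / 2 : ℝ) * (((Lc : ℝ) ^ (d + 1 + 1))⁻¹) ^ 4) *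
          ((Lc : ℝ) ^ 4 * ∑ r' ∈ box (d + 1) Lc, ∑' u' : Site (d + 1), ∑' x : Site (d + 1), ∑' z : Site (d + 1),
              (if toSite r' μ % (Lc : ℤ) = (Lc : ℤ) - 1 ∧ u' ν % (Lc : ℤ) = (Lc : ℤ) - 1 ∧ x α % (Lc : ℤ) = (Lc : ℤ) - 1 ∧ z β % (Lc : ℤ) = (Lc : ℤ) - 1
                then unitS₂ (sfStep Lc j) (smStep d Lc j) (T2RecAt d Lc (toSite r) cE cVH cΛ cE₂ cB Tc vh₂S (mixFFAt (toSite r) Lc) j)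
                  μ (toSite r') ν u' x z (Sum.inl α) (Sum.inl β) else 0)
           + (Lc : ℝ) ^ 4 * ∑ r' ∈ box (d + 1) Lc, ∑' u' : Site (d + 1), ∑' x : Site (d + 1), ∑' z : Site (d + 1),
              (if toSite r' ν % (Lc : ℤ) = (Lc : ℤ) - 1 ∧ u' μ % (Lc : ℤ) = (Lc : ℤ) - 1 ∧ x α % (Lc : ℤ) = (Lc : ℤ) - 1 ∧ z β % (Lc : ℤ) = (Lc : ℤ) - 1
                then unitS₂ (sfStep Lc j) (smStep d Lc j) (T2RecAt d Lc (toSite r) cE cVH cΛ cE₂ cB Tc vh₂S (mixFFAt (toSite r) Lc) j)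
                  ν (toSite r') μ u' x z (Sum.inl α) (Sum.inl β) else 0))) := by
  obtain ⟨CT, δT, hδT, hT⟩ := shape_member hLc hr cE cVH cΛ cE₂ cB Tc hB j
  have hTcov := member_translate (r := r) hLc cE cVH cΛ cE₂ cB Tc hBt j
  rw [zmode_succ_eq hLc hr cE cVH cΛ cE₂ cB Tc hBff hBmm hB hBt N j μ ν α β,
    zmode_tableDress_ff hLc hr hT hδT hTcov μ ν α β, zmode_tableDress_ff hLc hr hT hδT hTcov ν μ α β]

/-- NOT IN PRINT; OUR BOOKKEEPING ([folklore] Part 2 `zmode_stepE_eq` ∘ `zmode_tableDress_ff`).  **THE DRESSED STEP AS AN AFFINE MAP, FOUR-FACE FORM**: for every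
jointly `Lc`-covariant `LocStencil₂` input `X`, `zmode N (𝒜^E_j X + b̃_j) (μ,ν;α,β) = zmode N b̃_j (μ,ν;α,β) + λ̂·Lc⁴·(FF_Lc(X)(μ,ν;α,β) + FF_Lc(X)(ν,μ;α,β))` —
instances `X = T_j` (reference member: the (R-DEV) forcing's charge, with `zmode_stepB_eq`), `X = D_j` (leaf-06 g43's (★): `zmodeSym (D_{j+1}) = λ̂·Lc⁴·fourFaceSym (D_j) +
zmodeSym (g′_j)` — the OWNER's R3 `fourFaceSym (D₁) ≠ 0` is this term at D = 2). -/
theorem zmode_stepE_eq_fourFace (hLc : 1 ≤ Lc) (hr : r ∈ box (d + 1) Lc) (cE cVH cΛ cE₂ cB : ℝ) (Tc : Fin 4 → Fin 4 → Fin 4 → Fin 4 → ℝ)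
    {vh₂S : Tab d} (hBff : ∀ κ u κ' u' x z (α β : Fin (d + 1)), vh₂S κ u κ' u' x z (Sum.inl α) (Sum.inl β) = 0)
    (hBmm : ∀ κ u κ' u' x z (μ ν : Fin (d + 1)), vh₂S κ u κ' u' x z (Sum.inr μ) (Sum.inr ν) = 0)
    (hB : ∃ C δ : ℝ, 0 < δ ∧ LocStencil₂ vh₂S C δ) {X : Tab d} {CX δX : ℝ} (hX : LocStencil₂ X CX δX) (hδX : 0 < δX)
    (hXcov : ∀ κ u κ' u' t, X κ (u + (Lc : ℤ) • t) κ' (u' + (Lc : ℤ) • t) = shiftK (-((Lc : ℤ) • t)) (X κ u κ' u'))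
    (N j : ℕ) (μ ν α β : Fin (d + 1)) :
    zmode N (fun κ u κ' u' =>
          lin4 (cE₂ * (Lc : ℝ) ^ (2 * (d + 1))) (unitK (sfStep Lc j) (smStep d Lc j) (coDressKBmAt (toSite r) Lc (KInvStep (d := d) Lc j))) Lc X κ u κ' u'
        + ((cE₂ * (Lc : ℝ) ^ (2 * (d + 1))) • mmRead Lc (K3OfK
            (unitK (sfStep Lc j) (smStep d Lc j) (coDressKBmAt (toSite r) Lc (KInvStep (d := d) Lc j))) Lc
            (unitS (sfStep Lc j) (smStep d Lc j) (SpureRecAt d Lc (toSite r) cE cVH cΛ j)) (unitM (sfStep Lc j) (smStep d Lc j) (M1At d Lc (toSite r) cΛ j))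
            (W2SymOfK (unitK (sfStep Lc j) (smStep d Lc j) (coDressKBmAt (toSite r) Lc (KInvStep (d := d) Lc j))) Lc
              (unitS (sfStep Lc j) (smStep d Lc j) (SpureRecAt d Lc (toSite r) cE cVH cΛ j)) (unitM (sfStep Lc j) (smStep d Lc j) (M1At d Lc (toSite r) cΛ j)) 0
              (unitM₂ (sfStep Lc j) (smStep d Lc j) (M2Of d Lc (mixFFAt (toSite r) Lc) j))) κ u κ' u') + cB • vh₂S κ u κ' u'))
        μ ν (Sum.inl α) (Sum.inl β)
      = zmode N (fun κ u κ' u' => (cE₂ * (Lc : ℝ) ^ (2 * (d + 1))) • mmRead Lc (K3OfK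
            (unitK (sfStep Lc j) (smStep d Lc j) (coDressKBmAt (toSite r) Lc (KInvStep (d := d) Lc j))) Lc
            (unitS (sfStep Lc j) (smStep d Lc j) (SpureRecAt d Lc (toSite r) cE cVH cΛ j)) (unitM (sfStep Lc j) (smStep d Lc j) (M1At d Lc (toSite r) cΛ j))
            (W2SymOfK (unitK (sfStep Lc j) (smStep d Lc j) (coDressKBmAt (toSite r) Lc (KInvStep (d := d) Lc j))) Lc
              (unitS (sfStep Lc j) (smStep d Lc j) (SpureRecAt d Lc (toSite r) cE cVH cΛ j)) (unitM (sfStep Lc j) (smStep d Lc j) (M1At d Lc (toSite r) cΛ j)) 0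
              (unitM₂ (sfStep Lc j) (smStep d Lc j) (M2Of d Lc (mixFFAt (toSite r) Lc) j))) κ u κ' u') + cB • vh₂S κ u κ' u')
          μ ν (Sum.inl α) (Sum.inl β)
        + ((N : ℝ) ^ (d + 1)) * ((cE₂ * (Lc : ℝ) ^ (2 * (d + 1))) * ((1 / 2 : ℝ) * (((Lc : ℝ) ^ (d + 1 + 1))⁻¹) ^ 4) *
          ((Lc : ℝ) ^ 4 * ∑ r' ∈ box (d + 1) Lc, ∑' u' : Site (d + 1), ∑' x : Site (d + 1), ∑' z : Site (d + 1),
              (if toSite r' μ % (Lc : ℤ) = (Lc : ℤ) - 1 ∧ u' ν % (Lc : ℤ) = (Lc : ℤ) - 1 ∧ x α % (Lc : ℤ) = (Lc : ℤ) - 1 ∧ z β % (Lc : ℤ) = (Lc : ℤ) - 1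
                then X μ (toSite r') ν u' x z (Sum.inl α) (Sum.inl β) else 0)
           + (Lc : ℝ) ^ 4 * ∑ r' ∈ box (d + 1) Lc, ∑' u' : Site (d + 1), ∑' x : Site (d + 1), ∑' z : Site (d + 1),
              (if toSite r' ν % (Lc : ℤ) = (Lc : ℤ) - 1 ∧ u' μ % (Lc : ℤ) = (Lc : ℤ) - 1 ∧ x α % (Lc : ℤ) = (Lc : ℤ) - 1 ∧ z β % (Lc : ℤ) = (Lc : ℤ) - 1
                then X ν (toSite r') μ u' x z (Sum.inl α) (Sum.inl β) else 0))) := by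
  rw [zmode_stepE_eq hLc hr cE cVH cΛ cE₂ cB Tc hBff hBmm hB hX hδX hXcov N j μ ν α β,
    zmode_tableDress_ff hLc hr hX hδX hXcov μ ν α β, zmode_tableDress_ff hLc hr hX hδX hXcov ν μ α β]


/-! ## §2 The charge of the (R-DEV) forcing in closed form -/

/-- [folklore] **THE REFERENCE MEMBER IS JOINTLY `Lc`-COVARIANT** (an2's `T2RecOf_translate` at the comb data with `shiftK_KInvStep`, `SpureRecAt_translate`,
`M1At_translate`, an1's `hmixt_an1`; then `unitS₂_translate`). -/
theorem memberB_translate (hLc : 1 ≤ Lc) (cE cVH cΛ cE₂ cB : ℝ) (Tc : Fin 4 → Fin 4 → Fin 4 → Fin 4 → ℝ) {vh₂S : Tab d}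
    (hBt : ∀ (κ : Fin (d + 1)) (u : Fin (d + 1) → ℤ) (κ' : Fin (d + 1)) (u' t : Fin (d + 1) → ℤ),
      vh₂S κ (u + (Lc : ℤ) • t) κ' (u' + (Lc : ℤ) • t) = shiftK (-((Lc : ℤ) • t)) (vh₂S κ u κ' u')) (j : ℕ)
    (κ : Fin (d + 1)) (u : Fin (d + 1) → ℤ) (κ' : Fin (d + 1)) (u' t : Fin (d + 1) → ℤ) :
    unitS₂ (sfStep Lc j) (smStep d Lc j) (T2RecOf d Lc (fun j => KInvStep (d := d) Lc j) (SpureRecAt d Lc (toSite r) cE cVH cΛ)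
          (M1At d Lc (toSite r) cΛ) cE₂ cB Tc vh₂S (mixFFAt (toSite r) Lc) j) κ (u + (Lc : ℤ) • t) κ' (u' + (Lc : ℤ) • t)
      = shiftK (-((Lc : ℤ) • t)) (unitS₂ (sfStep Lc j) (smStep d Lc j) (T2RecOf d Lc (fun j => KInvStep (d := d) Lc j)
          (SpureRecAt d Lc (toSite r) cE cVH cΛ) (M1At d Lc (toSite r) cΛ) cE₂ cB Tc vh₂S (mixFFAt (toSite r) Lc) j) κ u κ' u') :=
  unitS₂_translate (w := (Lc : ℤ) • t) (v := -((Lc : ℤ) • t)) (sfStep Lc j) (smStep d Lc j)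
    (fun κ u κ' u' => T2RecOf_translate cE₂ cB Tc (fun j t => shiftK_KInvStep (d := d) (Lc := Lc) j t)
      (SpureRecAt_translate (toSite r) hLc cE cVH cΛ) (M1At_translate (Lc := Lc) (toSite r) cΛ) hBt (hmixt_an1 (toSite r)) j κ u κ' u' t)
    κ u κ' u'

/-- NOT IN PRINT; OUR BOOKKEEPING ([folklore] `zmode_stepE_eq_fourFace − zmode_stepB_eq` at `X := T_j`, symmetrised; the reference member's shape by
`shape_memberB`, covariance by `memberB_translate`).  **THE CHARGE OF THE (R-DEV) FORCING IN CLOSED FORM**: writing the OWNER's forcing as the difference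
of the two affine maps on the reference member, `g′_j = (𝒜^E_j T_j + b̃_j) − (𝒜^B_j T_j + b^B_j)`,
`zmodeSym_N (𝒜^E_j T_j + b̃_j) − zmodeSym_N (𝒜^B_j T_j + b^B_j) = [zmodeSym_N b̃_j − zmodeSym_N b^B_j] + 2λ̂·[Lc⁴·fourFaceSym_Lc (T_j) − zmodeSym_Lc (T_j)]`
— the second bracket is the FOUR-FACE DEFECT of the reference member; R-gan24p1-g23-4's «(Z′) false at j = 1» is this identity in numbers. -/
theorem zmodeSym_devForcing_eq_fourFace (hLc : 1 ≤ Lc) (hr : r ∈ box (d + 1) Lc) (cE cVH cΛ cE₂ cB : ℝ) (Tc : Fin 4 → Fin 4 → Fin 4 → Fin 4 → ℝ)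
    {vh₂S : Tab d} (hBff : ∀ κ u κ' u' x z (α β : Fin (d + 1)), vh₂S κ u κ' u' x z (Sum.inl α) (Sum.inl β) = 0)
    (hBmm : ∀ κ u κ' u' x z (μ ν : Fin (d + 1)), vh₂S κ u κ' u' x z (Sum.inr μ) (Sum.inr ν) = 0)
    (hB : ∃ C δ : ℝ, 0 < δ ∧ LocStencil₂ vh₂S C δ)
    (hBt : ∀ (κ : Fin (d + 1)) (u : Fin (d + 1) → ℤ) (κ' : Fin (d + 1)) (u' t : Fin (d + 1) → ℤ),
      vh₂S κ (u + (Lc : ℤ) • t) κ' (u' + (Lc : ℤ) • t) = shiftK (-((Lc : ℤ) • t)) (vh₂S κ u κ' u'))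
    (N j : ℕ) (μ ν α β : Fin (d + 1)) :
    let T : Tab d := unitS₂ (sfStep Lc j) (smStep d Lc j) (T2RecOf d Lc (fun j => KInvStep (d := d) Lc j) (SpureRecAt d Lc (toSite r) cE cVH cΛ)
          (M1At d Lc (toSite r) cΛ) cE₂ cB Tc vh₂S (mixFFAt (toSite r) Lc) j)
    let bE : Tab d := fun κ u κ' u' => (cE₂ * (Lc : ℝ) ^ (2 * (d + 1))) • mmRead Lc (K3OfK
            (unitK (sfStep Lc j) (smStep d Lc j) (coDressKBmAt (toSite r) Lc (KInvStep (d := d) Lc j))) Lc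
            (unitS (sfStep Lc j) (smStep d Lc j) (SpureRecAt d Lc (toSite r) cE cVH cΛ j)) (unitM (sfStep Lc j) (smStep d Lc j) (M1At d Lc (toSite r) cΛ j))
            (W2SymOfK (unitK (sfStep Lc j) (smStep d Lc j) (coDressKBmAt (toSite r) Lc (KInvStep (d := d) Lc j))) Lc
              (unitS (sfStep Lc j) (smStep d Lc j) (SpureRecAt d Lc (toSite r) cE cVH cΛ j)) (unitM (sfStep Lc j) (smStep d Lc j) (M1At d Lc (toSite r) cΛ j)) 0
              (unitM₂ (sfStep Lc j) (smStep d Lc j) (M2Of d Lc (mixFFAt (toSite r) Lc) j))) κ u κ' u') + cB • vh₂S κ u κ' u'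
    let bB : Tab d := fun κ u κ' u' => (cE₂ * (Lc : ℝ) ^ (2 * (d + 1))) • mmRead Lc (K3OfK
            (unitK (sfStep Lc j) (smStep d Lc j) (KInvStep (d := d) Lc j)) Lc
            (unitS (sfStep Lc j) (smStep d Lc j) (SpureRecAt d Lc (toSite r) cE cVH cΛ j)) (unitM (sfStep Lc j) (smStep d Lc j) (M1At d Lc (toSite r) cΛ j))
            (W2SymOfK (unitK (sfStep Lc j) (smStep d Lc j) (KInvStep (d := d) Lc j)) Lc
              (unitS (sfStep Lc j) (smStep d Lc j) (SpureRecAt d Lc (toSite r) cE cVH cΛ j)) (unitM (sfStep Lc j) (smStep d Lc j) (M1At d Lc (toSite r) cΛ j)) 0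
              (unitM₂ (sfStep Lc j) (smStep d Lc j) (M2Of d Lc (mixFFAt (toSite r) Lc) j))) κ u κ' u') + cB • vh₂S κ u κ' u'
    let stepE : Tab d := fun κ u κ' u' =>
          lin4 (cE₂ * (Lc : ℝ) ^ (2 * (d + 1))) (unitK (sfStep Lc j) (smStep d Lc j) (coDressKBmAt (toSite r) Lc (KInvStep (d := d) Lc j))) Lc T κ u κ' u'
        + bE κ u κ' u'
    let stepB : Tab d := fun κ u κ' u' =>
          lin4 (cE₂ * (Lc : ℝ) ^ (2 * (d + 1))) (unitK (sfStep Lc j) (smStep d Lc j) (KInvStep (d := d) Lc j)) Lc T κ u κ' u' + bB κ u κ' u'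
    (zmode N stepE μ ν (Sum.inl α) (Sum.inl β) + zmode N stepE ν μ (Sum.inl α) (Sum.inl β))
        - (zmode N stepB μ ν (Sum.inl α) (Sum.inl β) + zmode N stepB ν μ (Sum.inl α) (Sum.inl β))
      = ((zmode N bE μ ν (Sum.inl α) (Sum.inl β) + zmode N bE ν μ (Sum.inl α) (Sum.inl β))
          - (zmode N bB μ ν (Sum.inl α) (Sum.inl β) + zmode N bB ν μ (Sum.inl α) (Sum.inl β)))
        + ((N : ℝ) ^ (d + 1)) * ((cE₂ * (Lc : ℝ) ^ (2 * (d + 1))) * (((Lc : ℝ) ^ (d + 1 + 1))⁻¹) ^ 4) *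
          (((Lc : ℝ) ^ 4 * ∑ r' ∈ box (d + 1) Lc, ∑' u' : Site (d + 1), ∑' x : Site (d + 1), ∑' z : Site (d + 1),
              (if toSite r' μ % (Lc : ℤ) = (Lc : ℤ) - 1 ∧ u' ν % (Lc : ℤ) = (Lc : ℤ) - 1 ∧ x α % (Lc : ℤ) = (Lc : ℤ) - 1 ∧ z β % (Lc : ℤ) = (Lc : ℤ) - 1
                then T μ (toSite r') ν u' x z (Sum.inl α) (Sum.inl β) else 0)
            + (Lc : ℝ) ^ 4 * ∑ r' ∈ box (d + 1) Lc, ∑' u' : Site (d + 1), ∑' x : Site (d + 1), ∑' z : Site (d + 1),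
              (if toSite r' ν % (Lc : ℤ) = (Lc : ℤ) - 1 ∧ u' μ % (Lc : ℤ) = (Lc : ℤ) - 1 ∧ x α % (Lc : ℤ) = (Lc : ℤ) - 1 ∧ z β % (Lc : ℤ) = (Lc : ℤ) - 1
                then T ν (toSite r') μ u' x z (Sum.inl α) (Sum.inl β) else 0))
           - (zmode Lc T μ ν (Sum.inl α) (Sum.inl β) + zmode Lc T ν μ (Sum.inl α) (Sum.inl β))) := by
  intro T bE bB stepE stepB
  obtain ⟨CT, δT, hδT, hT⟩ := shape_memberB hLc hr cE cVH cΛ cE₂ cB Tc hB j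
  have hTcov := memberB_translate (r := r) hLc cE cVH cΛ cE₂ cB Tc hBt j
  have hE1 := zmode_stepE_eq_fourFace hLc hr cE cVH cΛ cE₂ cB Tc hBff hBmm hB hT hδT hTcov N j μ ν α β
  have hE2 := zmode_stepE_eq_fourFace hLc hr cE cVH cΛ cE₂ cB Tc hBff hBmm hB hT hδT hTcov N j ν μ α β
  have hB1 := zmode_stepB_eq hLc hr cE cVH cΛ cE₂ cB Tc hBff hBmm hB hT hδT hTcov N j μ ν α β
  have hB2 := zmode_stepB_eq hLc hr cE cVH cΛ cE₂ cB Tc hBff hBmm hB hT hδT hTcov N j ν μ α β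
  simp only [stepE, stepB, bE, bB, T] at hE1 hE2 hB1 hB2 ⊢
  rw [hE1, hE2, hB1, hB2]
  ring

end Summit.QuantumFields.BalabanUV.Beta.GAN24.T2RecChargeStepFourFace

end
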